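import Mathlib.Algebra.Polynomial.RuleOfSigns
import Mathlib.Algebra.Polynomial.Roots
import Mathlib.Analysis.Normed.Field.Basic

/-!
# `MatrixDescartes` census — LAGUERRE'S TWO-SIDED PARTIAL-SUM RULE (kernel version)

HONEST FRAMING.  Object-search cell `pub-symmetroid`, route crux `Theses.LacunarySymmetroid.MatrixDescartes`
(ledger item stmt-ValiantsHypothesis-18050).  This file is a kernel theorem about ONE arbitrary real polynomial; it is
the counting tool behind the cell's «end-kill» theorems on hypothetical Descartes-sharp fewnomials (theory-3 g13
THEOREM L18-LAGUERRE, 2026-08-25: `Z(F;(0,ρ)) ≤ V(lower sums at ρ)`, `Z(F;(ρ,∞)) ≤ V(upper sums at ρ)`, hence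
`Z(F) ≤ 3 < 5`).  Nothing here bears on `ζ_sym`, on `DoorA26` / `DoorA34`, on the crux, or on `VP ≠ VNP`.

THE STATEMENT (Laguerre 1883; Pólya–Szegő, *Aufgaben und Lehrsätze* II, Abschnitt V, Kap. 1, §1 — the partial-sum
refinements of Descartes' rule).  Let `f = Σ_j a_j X^j ∈ ℝ[X]`, `x > 0`, and put `S_m(x) = Σ_{j ≤ m} a_j x^j` (lower
partial sums) and `U_k(x) = Σ_{j ≥ k} a_j x^j` (upper partial sums).  Then the number of positive roots of `f`, counted
with multiplicity, is at most `V(S_0(x), S_1(x), …, S_n(x), U_1(x), …, U_n(x))` (`n = deg f`, sign variations with zeros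
skipped), in particular at most `V(S_0(x),…,S_n(x)) + V(U_0(x),…,U_n(x))` when `f(x) ≠ 0` (note `S_n = U_0 = f(x)`).

THE (FINITE) PROOF USED HERE.  For `M ≥ 1` the «Laguerre cofactor» `h_M := Σ_{k<M} x^{M-1-k} X^k` is positive on
`(0,∞)`, so `g := f · h_M` has exactly the positive roots of `f` (with multiplicity); and the ascending coefficients of
`g` are `x^{M-1-m} S_m(x)` for `m < M` and `x^{M-1-m}(S_m(x) − S_{m-M}(x))` for `m ≥ M` — with `M = n + 1` the latter are
`x^{-(m-n)} U_{m-n}(x)`.  Descartes' rule of signs for `g` (Mathlib `Polynomial.roots_countP_pos_le_signVariations`)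
gives the bound.  (The classical one-sided statements need the power series `f(t)/(x−t)`; the two-sided SUM, which is
what the end-kill theorems use, needs only this finite identity.)

CONTENTS: `laguerreCofactor` lemmas (`eval` positivity, no positive roots, coefficients), the root bound
`roots_countP_pos_le_signVariations_mul_laguerreCofactor` (multiplicity) / `card_posRoots_le_…` (distinct roots), and
the coefficient dictionary `coeff_mul_laguerreCofactor_of_lt` / `pow_mul_coeff_mul_laguerreCofactor_of_le` /
`…_natDegree_succ` (lower / upper partial sums), packaged as `laguerre_partial_sums`.  No `def`: the cofactor is
written out as a `Finset` sum everywhere.  COMPANION FILE `…CensusLaguerreSum.lean`: the splitting lemma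
`Var(A + X^k B) = Var(A) + Var(B) + [junction]` and the classical sum form `#Z₊(f) ≤ V(S₀..S_n) + V(U₀..U_n)`.
The mathematics is Literature-grade (a librarian may re-home it under `Literature/Algebra/Polynomial/` next to
`DescartesSignVariations.lean`); it sits here because the cell's kernel column cites `…Census` names.

[cite: PolyaSzego1925, Abschn. V Kap. 1 §1 (Laguerre)] for the rule; the finite-cofactor proof is [folklore].
-/

-- `Summit.ValiantsHypothesis.ValiantsHypothesis.…` repeats a component by the D-0017 layout
-- (single-conjunct summit), which the `dupNamespace` linter flags; the name is mandated.
set_option linter.dupNamespace false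

namespace Summit.ValiantsHypothesis.ValiantsHypothesis.Theorems.LacunarySymmetroidMatrixDescartes.Census

open Polynomial Finset
open scoped BigOperators Polynomial

/-! ### The Laguerre cofactor `h_M(x) = Σ_{k<M} x^{M-1-k} X^k` -/

/-- Evaluation of the Laguerre cofactor: `h_M(x)(t) = Σ_{k<M} x^{M-1-k} t^k`. [folklore] -/
theorem eval_laguerreCofactor (x t : ℝ) (M : ℕ) :
    (∑ k ∈ range M, C (x ^ (M - 1 - k)) * X ^ k : ℝ[X]).eval t = ∑ k ∈ range M, x ^ (M - 1 - k) * t ^ k := by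
  rw [eval_finsetSum]
  refine Finset.sum_congr rfl fun k _ => ?_
  rw [eval_mul, eval_C, eval_pow, eval_X]

/-- The Laguerre cofactor is positive on `(0,∞)` (indeed for `t ≥ 0` when `x > 0`, `M ≥ 1`). [folklore] -/
theorem eval_laguerreCofactor_pos {x t : ℝ} (hx : 0 < x) (ht : 0 < t) {M : ℕ} (hM : 0 < M) :
    0 < (∑ k ∈ range M, C (x ^ (M - 1 - k)) * X ^ k : ℝ[X]).eval t := by
  rw [eval_laguerreCofactor]
  exact Finset.sum_pos (fun k _ => mul_pos (pow_pos hx _) (pow_pos ht _)) ⟨0, by simp [hM]⟩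

/-- The Laguerre cofactor has no positive root. [folklore] -/
theorem roots_countP_pos_laguerreCofactor {x : ℝ} (hx : 0 < x) {M : ℕ} (hM : 0 < M) :
    (∑ k ∈ range M, C (x ^ (M - 1 - k)) * X ^ k : ℝ[X]).roots.countP (fun t => 0 < t) = 0 := by
  rw [Multiset.countP_eq_zero]
  intro t ht hpos
  have h := eval_laguerreCofactor_pos hx hpos hM
  rw [mem_roots', IsRoot.def] at ht
  rw [ht.2] at h
  exact lt_irrefl 0 h

/-- The Laguerre cofactor is non-zero (its constant coefficient is `x^{M-1} ≠ 0`). [folklore] -/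
theorem laguerreCofactor_ne_zero {x : ℝ} (hx : 0 < x) {M : ℕ} (hM : 0 < M) :
    (∑ k ∈ range M, C (x ^ (M - 1 - k)) * X ^ k : ℝ[X]) ≠ 0 := by
  intro h
  have := eval_laguerreCofactor_pos hx one_pos hM
  rw [h, eval_zero] at this
  exact lt_irrefl 0 this

/-- Coefficients of the Laguerre cofactor: `x^{M-1-i}` for `i < M`, `0` beyond. [folklore] -/
theorem coeff_laguerreCofactor (x : ℝ) (M i : ℕ) :
    (∑ k ∈ range M, C (x ^ (M - 1 - k)) * X ^ k : ℝ[X]).coeff i = if i < M then x ^ (M - 1 - i) else 0 := by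
  rw [finsetSum_coeff]
  simp_rw [coeff_C_mul, coeff_X_pow]
  split_ifs with hi
  · rw [Finset.sum_eq_single i]
    · simp
    · intro k _ hk; simp [Ne.symm hk]
    · intro hi'; exact absurd (mem_range.mpr hi) hi'
  · apply Finset.sum_eq_zero
    intro k hk
    have : i ≠ k := by intro e; subst e; exact hi (mem_range.mp hk)
    simp [this]

/-! ### Roots: `f` and `f · h_M` have the same positive roots -/

/-- **Laguerre, root form (with multiplicity).**  For `x > 0`, `M ≥ 1`: the positive roots of `f` (with multiplicity)
are at most the sign variations of `f · h_M(x)`. [cite: PolyaSzego1925, Abschn. V Kap. 1 §1 (Laguerre)] -/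
theorem roots_countP_pos_le_signVariations_mul_laguerreCofactor (f : ℝ[X]) {x : ℝ} (hx : 0 < x)
    {M : ℕ} (hM : 0 < M) :
    f.roots.countP (fun t => 0 < t) ≤
      (f * ∑ k ∈ range M, C (x ^ (M - 1 - k)) * X ^ k).signVariations := by
  by_cases hf : f = 0
  · simp [hf]
  set h : ℝ[X] := ∑ k ∈ range M, C (x ^ (M - 1 - k)) * X ^ k with hh
  have hne : f * h ≠ 0 := mul_ne_zero hf (laguerreCofactor_ne_zero hx hM)
  have hroots : (f * h).roots.countP (fun t => 0 < t) = f.roots.countP (fun t => 0 < t) := by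
    rw [roots_mul hne, Multiset.countP_add, roots_countP_pos_laguerreCofactor hx hM, add_zero]
  rw [← hroots]
  exact (f * h).roots_countP_pos_le_signVariations

/-- **Laguerre, root form (distinct roots).**  For `x > 0`, `M ≥ 1`: `#Z₊(f) ≤ Var(f · h_M(x))`.
[cite: PolyaSzego1925, Abschn. V Kap. 1 §1 (Laguerre)] -/
theorem card_posRoots_le_signVariations_mul_laguerreCofactor (f : ℝ[X]) {x : ℝ} (hx : 0 < x)
    {M : ℕ} (hM : 0 < M) :
    (f.roots.toFinset.filter (fun t => 0 < t)).card ≤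
      (f * ∑ k ∈ range M, C (x ^ (M - 1 - k)) * X ^ k).signVariations := by
  calc (f.roots.toFinset.filter (fun t => 0 < t)).card
      = (f.roots.filter (fun t => 0 < t)).toFinset.card := by rw [Multiset.toFinset_filter]
    _ ≤ (f.roots.filter (fun t => 0 < t)).card := Multiset.toFinset_card_le _
    _ = f.roots.countP (fun t => 0 < t) := (Multiset.countP_eq_card_filter _ _).symm
    _ ≤ _ := roots_countP_pos_le_signVariations_mul_laguerreCofactor f hx hM

/-! ### Coefficients of `f · h_M`: lower and upper partial sums -/

/-- Master coefficient formula: `coeff (f·h_M) m = Σ_{j ≤ m, m-j < M} a_j x^{M-1-(m-j)}`. [folklore] -/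
theorem coeff_mul_laguerreCofactor (f : ℝ[X]) (x : ℝ) (M m : ℕ) :
    (f * ∑ k ∈ range M, C (x ^ (M - 1 - k)) * X ^ k).coeff m =
      ∑ j ∈ range (m + 1), if m - j < M then f.coeff j * x ^ (M - 1 - (m - j)) else 0 := by
  rw [coeff_mul, Finset.Nat.sum_antidiagonal_eq_sum_range_succ_mk]
  refine Finset.sum_congr rfl fun j hj => ?_
  rw [coeff_laguerreCofactor]
  split_ifs <;> simp

/-- **Lower partial sums.**  For `m < M`: `coeff (f·h_M) m = x^{M-1-m} · S_m(x)`, `S_m(x) = Σ_{j ≤ m} a_j x^j`.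
[cite: PolyaSzego1925, Abschn. V Kap. 1 §1 (Laguerre)] -/
theorem coeff_mul_laguerreCofactor_of_lt (f : ℝ[X]) (x : ℝ) {M m : ℕ} (hm : m < M) :
    (f * ∑ k ∈ range M, C (x ^ (M - 1 - k)) * X ^ k).coeff m =
      x ^ (M - 1 - m) * ∑ j ∈ range (m + 1), f.coeff j * x ^ j := by
  rw [coeff_mul_laguerreCofactor, Finset.mul_sum]
  refine Finset.sum_congr rfl fun j hj => ?_
  have hj' : j ≤ m := Nat.lt_succ_iff.mp (mem_range.mp hj)
  have h1 : m - j < M := lt_of_le_of_lt (Nat.sub_le m j) hm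
  rw [if_pos h1]
  have h2 : M - 1 - (m - j) = (M - 1 - m) + j := by omega
  rw [h2, pow_add]; ring

/-- **Upper window.**  For `M ≤ m`: `x^{m+1-M} · coeff (f·h_M) m = Σ_{m+1-M ≤ j ≤ m} a_j x^j = S_m(x) − S_{m-M}(x)`.
[cite: PolyaSzego1925, Abschn. V Kap. 1 §1 (Laguerre)] -/
theorem pow_mul_coeff_mul_laguerreCofactor_of_le (f : ℝ[X]) (x : ℝ) {M m : ℕ} (hm : M ≤ m) :
    x ^ (m + 1 - M) * (f * ∑ k ∈ range M, C (x ^ (M - 1 - k)) * X ^ k).coeff m =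
      ∑ j ∈ Icc (m + 1 - M) m, f.coeff j * x ^ j := by
  rw [coeff_mul_laguerreCofactor, Finset.mul_sum]
  -- split the range at `m + 1 - M`: below it the summand vanishes
  have hsplit : range (m + 1) = range (m + 1 - M) ∪ Icc (m + 1 - M) m := by
    ext j; simp only [mem_union, mem_range, mem_Icc]; omega
  rw [hsplit, Finset.sum_union]
  · have hz : ∑ j ∈ range (m + 1 - M), x ^ (m + 1 - M) *
        (if m - j < M then f.coeff j * x ^ (M - 1 - (m - j)) else 0) = 0 := by
      apply Finset.sum_eq_zero
      intro j hj
      have : ¬ (m - j < M) := by have := mem_range.mp hj; omega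
      rw [if_neg this, mul_zero]
    rw [hz, zero_add]
    refine Finset.sum_congr rfl fun j hj => ?_
    rw [mem_Icc] at hj
    have h1 : m - j < M := by omega
    rw [if_pos h1]
    have h2 : (m + 1 - M) + (M - 1 - (m - j)) = j := by omega
    calc x ^ (m + 1 - M) * (f.coeff j * x ^ (M - 1 - (m - j)))
        = f.coeff j * (x ^ (m + 1 - M) * x ^ (M - 1 - (m - j))) := by ring
      _ = f.coeff j * x ^ j := by rw [← pow_add, h2]
  · rw [Finset.disjoint_left]
    intro j hj hj'
    rw [mem_range] at hj; rw [mem_Icc] at hj'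
    omega

/-- **Upper partial sums at `M = n + 1`, `n = natDegree f`.**  For `n < m`:
`x^{m-n} · coeff (f·h_{n+1}) m = U_{m-n}(x) := Σ_{m-n ≤ j ≤ n} a_j x^j` (the coefficients above `n` vanish).
[cite: PolyaSzego1925, Abschn. V Kap. 1 §1 (Laguerre)] -/
theorem pow_mul_coeff_mul_laguerreCofactor_natDegree_succ (f : ℝ[X]) (x : ℝ) {m : ℕ}
    (hm : f.natDegree < m) :
    x ^ (m - f.natDegree) * (f * ∑ k ∈ range (f.natDegree + 1), C (x ^ (f.natDegree + 1 - 1 - k)) * X ^ k).coeff m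
      = ∑ j ∈ Icc (m - f.natDegree) f.natDegree, f.coeff j * x ^ j := by
  have hle : f.natDegree + 1 ≤ m := hm
  have h := pow_mul_coeff_mul_laguerreCofactor_of_le f x hle
  have e1 : m + 1 - (f.natDegree + 1) = m - f.natDegree := by omega
  rw [e1] at h
  rw [h]
  -- drop the vanishing coefficients above `natDegree`
  symm
  apply Finset.sum_subset
  · intro j hj
    rw [mem_Icc] at hj ⊢
    exact ⟨hj.1, hj.2.trans hm.le⟩
  · intro j hj hj'
    rw [mem_Icc] at hj hj'
    have : f.natDegree < j := by
      by_contra hc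
      exact hj' ⟨hj.1, not_lt.mp hc⟩
    rw [coeff_eq_zero_of_natDegree_lt this, zero_mul]

/-- Lower partial sums at `M = n + 1`: for `m ≤ n = natDegree f`, `coeff (f·h_{n+1}) m = x^{n-m} · S_m(x)`.
[cite: PolyaSzego1925, Abschn. V Kap. 1 §1 (Laguerre)] -/
theorem coeff_mul_laguerreCofactor_natDegree_succ (f : ℝ[X]) (x : ℝ) {m : ℕ} (hm : m ≤ f.natDegree) :
    (f * ∑ k ∈ range (f.natDegree + 1), C (x ^ (f.natDegree + 1 - 1 - k)) * X ^ k).coeff m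
      = x ^ (f.natDegree - m) * ∑ j ∈ range (m + 1), f.coeff j * x ^ j := by
  have h := coeff_mul_laguerreCofactor_of_lt f x (Nat.lt_succ_of_le hm)
  have e1 : f.natDegree + 1 - 1 - m = f.natDegree - m := by omega
  rw [e1] at h
  exact h

/-- The product `f · h_{n+1}` has degree at most `2n`: its coefficients vanish above `2 · natDegree f`. [folklore] -/
theorem coeff_mul_laguerreCofactor_eq_zero (f : ℝ[X]) (x : ℝ) {m : ℕ} (hm : 2 * f.natDegree < m) :
    (f * ∑ k ∈ range (f.natDegree + 1), C (x ^ (f.natDegree + 1 - 1 - k)) * X ^ k).coeff m = 0 := by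
  rw [coeff_mul_laguerreCofactor]
  apply Finset.sum_eq_zero
  intro j hj
  split_ifs with h1
  · have : f.natDegree < j := by have := mem_range.mp hj; omega
    rw [coeff_eq_zero_of_natDegree_lt this, zero_mul]
  · rfl

/-- **LAGUERRE'S TWO-SIDED PARTIAL-SUM RULE, packaged.**  For a real polynomial `f` of degree `n` and `x > 0`, with
`g := f · Σ_{k ≤ n} x^{n-k} X^k`:  (i) `#{positive roots of f, with multiplicity} ≤ Var(g)`;  (ii) for `m ≤ n` the
coefficient `g_m` is `x^{n-m}` times the LOWER partial sum `S_m(x) = Σ_{j ≤ m} a_j x^j`;  (iii) for `n < m` the number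
`x^{m-n} g_m` is the UPPER partial sum `U_{m-n}(x) = Σ_{m-n ≤ j ≤ n} a_j x^j`;  (iv) `g_m = 0` for `m > 2n`.  Hence the
sign sequence of `g` is `(sgn S_0(x), …, sgn S_n(x), sgn U_1(x), …, sgn U_n(x))` and `Var(g)` is the number of sign
changes of that sequence with zeros skipped — Laguerre's `Z(f;(0,x)) + Z(f;(x,∞))` bound in summed form, `≤ V(S) + V(U)`
when `f(x) = S_n(x) = U_0(x) ≠ 0`. [cite: PolyaSzego1925, Abschn. V Kap. 1 §1 (Laguerre)] -/
theorem laguerre_partial_sums (f : ℝ[X]) {x : ℝ} (hx : 0 < x) :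
    f.roots.countP (fun t => 0 < t) ≤
        (f * ∑ k ∈ range (f.natDegree + 1), C (x ^ (f.natDegree + 1 - 1 - k)) * X ^ k).signVariations ∧
      (∀ m, m ≤ f.natDegree →
        (f * ∑ k ∈ range (f.natDegree + 1), C (x ^ (f.natDegree + 1 - 1 - k)) * X ^ k).coeff m
          = x ^ (f.natDegree - m) * ∑ j ∈ range (m + 1), f.coeff j * x ^ j) ∧
      (∀ m, f.natDegree < m →
        x ^ (m - f.natDegree) *
            (f * ∑ k ∈ range (f.natDegree + 1), C (x ^ (f.natDegree + 1 - 1 - k)) * X ^ k).coeff m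
          = ∑ j ∈ Icc (m - f.natDegree) f.natDegree, f.coeff j * x ^ j) ∧
      (∀ m, 2 * f.natDegree < m →
        (f * ∑ k ∈ range (f.natDegree + 1), C (x ^ (f.natDegree + 1 - 1 - k)) * X ^ k).coeff m = 0) :=
  ⟨roots_countP_pos_le_signVariations_mul_laguerreCofactor f hx (Nat.succ_pos _),
    fun _ hm => coeff_mul_laguerreCofactor_natDegree_succ f x hm,
    fun _ hm => pow_mul_coeff_mul_laguerreCofactor_natDegree_succ f x hm,
    fun _ hm => coeff_mul_laguerreCofactor_eq_zero f x hm⟩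

end Summit.ValiantsHypothesis.ValiantsHypothesis.Theorems.LacunarySymmetroidMatrixDescartes.Census
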